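import Summits.Ventures.HodgeRepro.Tier3LemmaRGeneratorEigen
import Summits.Ventures.HodgeRepro.Tier3WeilLineScalars

/-!
# LEMMA R's generator, its Weil line identified with `∧^{2k}_K V_B`, and the `K`-structure in one statement:
`q ∘ act(a) = a • q` and `∧^{2k}_K V_B = K · q(e₀ (⋀^{2k} M η))` on the data of `exists_weil_line_generator`

Blind re-derivation cell `pub-hodge-repro`, seat `t3-p4` (Tier 3, T3.5 for T3.4 = Lemma R).  Target tree path
`lean/Summits/Ventures/HodgeRepro/Tier3LemmaRGeneratorScalars.lean`; imports the cell's `Tier3LemmaRGeneratorEigen`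
and `Tier3WeilLineScalars`.

WHAT THIS FILE STATES (`exists_weil_line_generator_scalars`; LEMMA-R-RESIDUE.md §4(b) + §4(d) + §5–§6 in ONE
existential).  The conclusion of `Tier3LemmaRGeneratorEigen.exists_weil_line_generator_restrictScalars` — LEMMA R's
generator with the eigen-relations, the restriction-of-scalars map `q` and Deligne's direct summand for its Weil line
`W_F` — with three clauses added from `Tier3WeilLineScalars`: `q (act(a) v) = a • q v` for every `v` (inserted after
`Function.Surjective q`), and, inside the LEMMA R clause, `q w₀ ≠ 0` and «every `y ∈ ⋀[K]^{2k} V_B` is `a • q w₀` for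
exactly one `a ∈ K`» for the generator `w₀ = e₀ (⋀^{2k} M η)` (inserted before the `act(a)`-generation clause).

Read with `V_red = H¹(B_red, ℚ)`, `V_B = H¹(B, ℚ)`, `K = F`, `F₀ = ℚ`, `2k = 2p`: LEMMA R's conclusion
«`W_F(B) = {act(a)(e · m^* η) : a ∈ F}`» is, through Deligne's identification `q|_{W_F} : W_F ≅ ∧^{2p}_F H¹(B, ℚ)`, the
statement that `∧^{2p}_F H¹(B, ℚ)` is the `F`-line through `q(e · m^* η)` with `act(a)` the scalar `a` — §4(d)'s
«`dim_F W_F(B) = 1`, spanned by any non-zero vector» and §4(b)'s «`W_F(B) := ∧^{2p}_F H¹(B, ℚ)`» in the same statement as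
the generator.  Nothing mathematical moves (LEMMA-R-RESIDUE v15: residue 0 unchanged); the proof is a composition.

HONESTY.  Linear algebra on the cell's own modules; no definition is introduced; nothing geometric is built.
HC_CM is NOT proved by anyone in this repository.
-/

set_option autoImplicit false

open TensorProduct Finset

namespace HodgeRepro.Tier3

open HodgeRepro.RouteC HodgeRepro.CMHodgeOn

section GeneratorScalars

variable {F₀ K : Type*} [Field F₀] [Field K] [Algebra F₀ K]
variable {Vr VB : Type*} [AddCommGroup Vr] [Module K Vr] [Module F₀ Vr] [IsScalarTower F₀ K Vr]
  [AddCommGroup VB] [Module K VB] [Module F₀ VB] [IsScalarTower F₀ K VB]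
variable {J ι : Type*} [Fintype J] [DecidableEq J] [Fintype ι] [LinearOrder ι] [DecidableEq (K ≃ₐ[F₀] K)]
variable [FiniteDimensional F₀ K] [IsGalois F₀ K] [Algebra K ℂ]

/-- **LEMMA R's generator, Deligne's identification and the `K`-structure in one statement**
(`exists_weil_line_generator_restrictScalars` + `Tier3WeilLineScalars.restrictScalars_map_update` /
`scalars_of_weil_line_generator`): `q ∘ act(a) = a • q`, and for the generator `w₀ = e₀ (⋀^{2k} M η)` of the Weil line,
`q w₀ ≠ 0` and `⋀[K]^{2k} V_B = K • q w₀` with unique coefficients — «`∧^{2p}_F H¹(B, ℚ) = F · q(e · m^* η)`».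
`ι` carries the `LinearOrder` that `Tier3WeilLineScalars` enumerates the wedge basis with (its `DecidableEq` is the
derived one, as there). -/
theorem exists_weil_line_generator_scalars {k : ℕ} [Nonempty ι]
    (cls : ι → J) (tw : ι → K ≃ₐ[F₀] K) (hinj : Function.Injective fun i => (cls i, tw i))
    (hcard : Fintype.card ι = 2 * k)
    (ω : Module.Basis J K Vr) (ω' : Module.Basis ι K VB) (M : Vr →ₗ[F₀] VB)
    (hM : ∀ (c : K) (j : J), M (c • ω j) = ∑ i ∈ univ.filter (fun i => cls i = j), ((tw i)⁻¹ c) • ω' i)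
    [LinearOrder (J × (K ≃ₐ[F₀] K))] [LinearOrder (ι × (K ≃ₐ[F₀] K))]
    [MulAction (K ≃ₐ[F₀] K) (J × (K ≃ₐ[F₀] K))]
    (hact : ∀ (σ x : K ≃ₐ[F₀] K) (j : J), σ • (j, x) = (j, σ * x))
    [MulAction (K ≃ₐ[F₀] K) (ι × (K ≃ₐ[F₀] K))]
    (hact' : ∀ (σ x : K ≃ₐ[F₀] K) (i : ι), σ • (i, x) = (i, σ * x))
    (i₀ : ι) :
    ∃ (e : Module.Basis (J × (K ≃ₐ[F₀] K)) K (K ⊗[F₀] Vr))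
      (E : Module.Basis (Set.powersetCard (J × (K ≃ₐ[F₀] K)) (2 * k)) K (K ⊗[F₀] ⋀[F₀]^(2 * k) Vr))
      (Φ : K ⊗[F₀] ⋀[F₀]^(2 * k) Vr ≃ₗ[K] ⋀[K]^(2 * k) (K ⊗[F₀] Vr))
      (e' : Module.Basis (ι × (K ≃ₐ[F₀] K)) K (K ⊗[F₀] VB))
      (E' : Module.Basis (Set.powersetCard (ι × (K ≃ₐ[F₀] K)) (2 * k)) K (K ⊗[F₀] ⋀[F₀]^(2 * k) VB))
      (Φ' : K ⊗[F₀] ⋀[F₀]^(2 * k) VB ≃ₗ[K] ⋀[K]^(2 * k) (K ⊗[F₀] VB))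
      (WF : Submodule F₀ (⋀[F₀]^(2 * k) VB))
      (e₀ : ⋀[F₀]^(2 * k) VB →ₗ[F₀] ⋀[F₀]^(2 * k) VB)
      (q : ⋀[F₀]^(2 * k) VB →ₗ[F₀] ⋀[K]^(2 * k) VB),
      (∀ (σ x : K ≃ₐ[F₀] K) (j : J), LinearMap.rTensor Vr σ.toLinearMap (e (j, x)) = e (j, σ * x)) ∧
      (∀ (σ x : K ≃ₐ[F₀] K) (i : ι), LinearMap.rTensor VB σ.toLinearMap (e' (i, x)) = e' (i, σ * x)) ∧
      (∀ (x : K ≃ₐ[F₀] K) (j : J) (b : J → K),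
        LinearMap.lTensor K ((ω.constr K fun j => b j • ω j).restrictScalars F₀) (e (j, x)) =
          x (b j) • e (j, x)) ∧
      (∀ (x : K ≃ₐ[F₀] K) (i : ι) (b : ι → K),
        LinearMap.lTensor K ((ω'.constr K fun i => b i • ω' i).restrictScalars F₀) (e' (i, x)) =
          x (b i) • e' (i, x)) ∧
      (∀ (x : K ≃ₐ[F₀] K) (i : ι) (b : K),
        LinearMap.lTensor K ((LinearMap.lsmul K VB b).restrictScalars F₀) (e' (i, x)) = x b • e' (i, x)) ∧
      (∀ (x : K ≃ₐ[F₀] K) (j : J),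
        LinearMap.lTensor K M (e (j, x)) = ∑ i ∈ univ.filter (fun i => cls i = j), e' (i, x * tw i)) ∧
      (∀ (c : K) (v : Fin (2 * k) → Vr),
        Φ (c ⊗ₜ[F₀] exteriorPower.ιMulti F₀ (2 * k) v) =
          c • exteriorPower.ιMulti K (2 * k) (fun i => (1 : K) ⊗ₜ[F₀] v i)) ∧
      (∀ (c : K) (w : Fin (2 * k) → VB),
        Φ' (c ⊗ₜ[F₀] exteriorPower.ιMulti F₀ (2 * k) w) =
          c • exteriorPower.ιMulti K (2 * k) (fun i => (1 : K) ⊗ₜ[F₀] w i)) ∧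
      (∀ s, Φ (E s) = exteriorPower.ιMulti_family K (2 * k) e s) ∧
      (∀ s, Φ' (E' s) = exteriorPower.ιMulti_family K (2 * k) e' s) ∧
      -- the Weil line and its rational projector
      WF.baseChange K =
        Submodule.span K (E' '' {L | ∃ σ : K ≃ₐ[F₀] K, (L : Finset (ι × (K ≃ₐ[F₀] K))) = lineSet σ}) ∧
      (∀ v, e₀ v ∈ WF) ∧ (∀ w ∈ WF, e₀ w = w) ∧
      (∀ (v : ⋀[F₀]^(2 * k) VB) (L : Set.powersetCard (ι × (K ≃ₐ[F₀] K)) (2 * k)),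
        E'.repr ((1 : K) ⊗ₜ[F₀] e₀ v) L =
          if ∃ σ : K ≃ₐ[F₀] K, (L : Finset (ι × (K ≃ₐ[F₀] K))) = lineSet σ
          then E'.repr ((1 : K) ⊗ₜ[F₀] v) L else 0) ∧
      Module.finrank F₀ WF = Module.finrank F₀ K ∧
      -- Deligne's direct summand: the Weil line IS `⋀[K]^(2k) VB` through the restriction-of-scalars map `q`
      (∀ w : Fin (2 * k) → VB, q (exteriorPower.ιMulti F₀ (2 * k) w) = exteriorPower.ιMulti K (2 * k) w) ∧
      Function.Surjective q ∧
      -- the first corner's multiplication by `a` IS the scalar `a` on `⋀[K]^(2k) VB` through `q`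
      (∀ (a : K) (v : ⋀[F₀]^(2 * k) VB), q (exteriorPower.map (2 * k)
        ((ω'.constr K fun i => Function.update (fun _ => (1 : K)) i₀ a i • ω' i).restrictScalars F₀) v) = a • q v) ∧
      (∀ L : Set.powersetCard (ι × (K ≃ₐ[F₀] K)) (2 * k),
        (¬ ∃ σ : K ≃ₐ[F₀] K, (L : Finset (ι × (K ≃ₐ[F₀] K))) = lineSet σ) → q.baseChange K (E' L) = 0) ∧
      (∀ (L : Set.powersetCard (ι × (K ≃ₐ[F₀] K)) (2 * k)) (σ : K ≃ₐ[F₀] K),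
        (L : Finset (ι × (K ≃ₐ[F₀] K))) = lineSet σ → ∀ b : K,
        LinearMap.lTensor K ((LinearMap.lsmul K (⋀[K]^(2 * k) VB) b).restrictScalars F₀) (q.baseChange K (E' L)) =
          σ b • q.baseChange K (E' L)) ∧
      (∀ U : (K ≃ₐ[F₀] K) → Set.powersetCard (ι × (K ≃ₐ[F₀] K)) (2 * k),
        (∀ σ, (U σ : Finset (ι × (K ≃ₐ[F₀] K))) = lineSet σ) →
        LinearIndependent K (fun σ => q.baseChange K (E' (U σ))) ∧
        Submodule.span K (Set.range fun σ => q.baseChange K (E' (U σ))) = ⊤) ∧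
      (∀ v ∈ WF, q v = 0 → v = 0) ∧
      (∀ y : ⋀[K]^(2 * k) VB, ∃ v ∈ WF, q v = y) ∧
      IsCompl WF (LinearMap.ker q) ∧
      (∃ s : ⋀[K]^(2 * k) VB →ₗ[F₀] ⋀[F₀]^(2 * k) VB,
        (∀ y, q (s y) = y) ∧ (∀ y, s y ∈ WF) ∧ (∀ w ∈ WF, s (q w) = w)) ∧
      -- LEMMA R: the generator `e · m^* η` of the Weil line under the first corner's `K`-action
      ∀ (W : Submodule F₀ (⋀[F₀]^(2 * k) Vr)),
        (∀ s : Set.powersetCard (J × (K ≃ₐ[F₀] K)) (2 * k),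
          (∃ σ, (s : Finset (J × (K ≃ₐ[F₀] K))) = reducedSet cls tw σ) → E s ∈ W.baseChange K) →
        ∃ η ∈ W, η ≠ 0 ∧
          e₀ (exteriorPower.map (2 * k) M η) ∈ WF ∧ e₀ (exteriorPower.map (2 * k) M η) ≠ 0 ∧
          -- the image of the generator spans `⋀[K]^(2k) VB` over `K`: `∧^{2p}_F H¹(B, ℚ) = F · q(e · m^* η)`
          q (e₀ (exteriorPower.map (2 * k) M η)) ≠ 0 ∧
          (∀ y : ⋀[K]^(2 * k) VB, ∃! a : K, y = a • q (e₀ (exteriorPower.map (2 * k) M η))) ∧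
          ∀ x ∈ WF, ∃ a : K, x = exteriorPower.map (2 * k)
            ((ω'.constr K fun i => Function.update (fun _ => (1 : K)) i₀ a i • ω' i).restrictScalars F₀)
            (e₀ (exteriorPower.map (2 * k) M η)) := by
  classical
  obtain ⟨e, E, Φ, e', E', Φ', WF, e₀, q, he1, he1', he2, he2', hscal, hMe, hΦ, hΦ', hE, hE', hWF, he₀mem, he₀id,
      hrepr, hdim, hq, hqsurj, h1, h2, h3, h4, h5, h6, hs, hW⟩ :=
    exists_weil_line_generator_restrictScalars cls tw hinj hcard ω ω' M hM hact hact' i₀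
  refine ⟨e, E, Φ, e', E', Φ', WF, e₀, q, he1, he1', he2, he2', hscal, hMe, hΦ, hΦ', hE, hE', hWF, he₀mem, he₀id,
    hrepr, hdim, hq, hqsurj, fun a v => restrictScalars_map_update hcard ω' q hq i₀ a v, h1, h2, h3, h4, h5, h6, hs,
    fun W hPW => ?_⟩
  obtain ⟨η, hηW, hη0, hmem, hne, hgen⟩ := hW W hPW
  obtain ⟨hq0, hall⟩ := scalars_of_weil_line_generator hcard ω' q hq WF h4 h5 i₀ _ hmem hne hgen
  exact ⟨η, hηW, hη0, hmem, hne, hq0, hall, hgen⟩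

end GeneratorScalars

end HodgeRepro.Tier3
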